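import Summits.PneNP.PneNP.Theorems.ExpanderLinearGeneratorsExpansionForcesDepthFregeSizeOfGaussianWidth
import Mathlib.LinearAlgebra.Dimension.Constructions
import Mathlib.LinearAlgebra.Dimension.Finite
import Mathlib.LinearAlgebra.FiniteDimensional.Defs

/-!
# PneNP / ExpanderLinearGenerators — the DETERMINATION BARRIER for local derivations in
boundary expanders (helper file for stmt-PneNP-11442, `--supports`)

Route `PneNP/ExpanderLinearGenerators`, crux stmt-PneNP-11442
(`Summit.PneNP.PneNP.Theses.ExpanderLinearGenerators.ExpansionForcesDepthFregeSize`).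
The route's `why_might_fail` asks whether a structured column-weight-`> 2` expander could carry a
cheap bounded-depth refutation built from a COUNTING or ORDERING frame (WPHP-style counting,
induction along an order) whose axioms are derived LOCALLY, i.e. from at most `r` rows each.
Every local consequence of an `(r, c)`-boundary expander over `𝔽₂` is the sum of a row set `I`,
`|I| ≤ r`, and its support contains the boundary `∂I`
(`boundary_subset_map_supp_lincomb`, file `…OfGaussianWidth`). This file kernel-checks the
quantitative consequence that kills ordering / transitivity / pointer / padding frames
(memo `memo-11442-s21-counting-frame-barrier.md`, evidence on the item, §2 "DP"):

* `boundary_biUnion_subset` — the boundary of a union of row sets lies in the union of their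
  boundaries (a point covered once by the union is covered once by the member containing its row).
* `linearIndependent_of_unit_support` — vectors `w_v`, `v ∈ T`, with `w_v v ≠ 0` and `w_v u = 0`
  for `u ∈ T ∖ {v}` are linearly independent.
* `card_determined_le` — **Determination Principle.** If `F`, `T` are disjoint sets of variables
  and every `v ∈ T` is *locally forced by `F`* — some row set `I_v` inside one row set `A` with
  `|A| ≤ r` has sum supported in `F ∪ {v}` and containing `v` (semantically: on the solutions of
  `A`, the values on `F` determine the value of `v`) — then `(c - 1)·|T| ≤ |F|`.
  Proof: `A' := ⋃_v I_v ⊆ A` has `∂A' ⊆ F ∪ T` (union lemma + no cancellation at unique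
  neighbours), so `c|A'| ≤ |F| + |T|` by expansion, while the sums `w_v` are `|T|` linearly
  independent vectors in the span of the `|A'|` rows of `A'`, so `|T| ≤ |A'|`.
* `card_determined_le_route` — the route's normalisation `c = 3/4·ℓ`: `(3ℓ/4 - 1)|T| ≤ |F|`;
  for `ℓ = 9`, `w` locally fixed bits force at most `0.174·w` further bits, so e.g. transitivity
  of pattern predicates of equal width (`|F| = 2|T|`) is not locally derivable once `ℓ ≥ 5`.
* `not_locallyPinned` — in particular (`F = ∅`, `c > 1`) no single variable is pinned by a local
  row set.

References: E. Ben-Sasson, A. Wigderson, *Short proofs are narrow — resolution made simple*,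
J. ACM 48 (2001), §5–6 (boundary expansion) [BenSassonWigderson2001]; J. Krajíček,
*Proof Complexity* (CUP 2019), §13.4 [KrajicekProofComplexity2019].
-/

namespace Summit.PneNP.PneNP.Theorems

set_option linter.dupNamespace false -- `Summit.PneNP.PneNP.…`: summit = sub-problem (D-0017)

open Finset Literature.Computability.MetaComplexity Literature.Computability.Complexity

namespace DeterminationBarrier

/-- **Boundary of a union.** A unique-neighbour point of `⋃_{t ∈ T} I_t` is a unique-neighbour
point of some member `I_t` (the one containing the unique row through the point). [folklore] -/
theorem boundary_biUnion_subset {ι κ : Type*} [DecidableEq ι] [DecidableEq κ]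
    (S : ι → Finset ℕ) (T : Finset κ) (I : κ → Finset ι) :
    boundary S (T.biUnion I) ⊆ T.biUnion fun t => boundary S (I t) := by
  intro v hv
  obtain ⟨e, ⟨heU, hve⟩, huniq⟩ := existsUnique_of_mem_boundary hv
  obtain ⟨t, ht, het⟩ := Finset.mem_biUnion.1 heU
  refine Finset.mem_biUnion.2 ⟨t, ht, ?_⟩
  rw [mem_boundary]
  refine ⟨mem_cover.2 ⟨e, het, hve⟩, ?_⟩
  unfold coverDegree
  rw [Finset.card_eq_one]
  refine ⟨e, ?_⟩
  ext e'
  simp only [Finset.mem_filter, Finset.mem_singleton]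
  constructor
  · rintro ⟨he', hve'⟩
    exact huniq e' ⟨Finset.mem_biUnion.2 ⟨t, ht, he'⟩, hve'⟩
  · rintro rfl
    exact ⟨het, hve⟩

/-- **Unit supports are independent.** If `w : T → (Fin n → 𝔽₂)` satisfies `w v v ≠ 0` and
`w u v = 0` for `u ≠ v` in `T`, the family is linearly independent (evaluate a vanishing linear
combination at the coordinate `v`). [folklore] -/
theorem linearIndependent_of_unit_support {n : ℕ} (T : Finset (Fin n))
    (w : Fin n → (Fin n → ZMod 2)) (hdiag : ∀ v ∈ T, w v v ≠ 0)
    (hoff : ∀ u ∈ T, ∀ v ∈ T, u ≠ v → w u v = 0) :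
    LinearIndependent (ZMod 2) (fun v : T => w v) := by
  rw [linearIndependent_iff']
  intro s g hsum i hi
  have h := congrFun hsum (i : Fin n)
  rw [Finset.sum_apply, Finset.sum_eq_single i] at h
  · simp only [Pi.smul_apply, smul_eq_mul, Pi.zero_apply] at h
    rcases mul_eq_zero.1 h with h0 | h0
    · exact h0
    · exact absurd h0 (hdiag i i.2)
  · intro j _ hji
    simp only [Pi.smul_apply, smul_eq_mul]
    have hne : (j : Fin n) ≠ i := fun h' => hji (Subtype.ext h')
    rw [hoff j j.2 i i.2 hne, mul_zero]
  · intro his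
    exact absurd hi his

/-- **Determination Principle** (local derivations never amplify information). Let the row
supports of `E` form an `(r, c)`-boundary expander, let `A` be a row set with `|A| ≤ r`, and let
`F`, `T` be disjoint sets of variables such that every `v ∈ T` is forced by `F` through `A`: some
`I_v ⊆ A` has row sum supported in `F ∪ {v}` with `v` in the support. Then `(c - 1)·|T| ≤ |F|`.
[Ben-Sasson–Wigderson 2001, §5–6 (boundary expansion, no cancellation); this quantitative form:
memo-11442-s21 §2 (DP)] [folklore] -/
theorem card_determined_le {m n : ℕ} (E : Fin m → LinEqMod 2 n) {r c : ℝ}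
    (hexp : IsBoundaryExpander (fun i => (E i).supp.map Fin.valEmbedding) r c)
    (A : Finset (Fin m)) (hA : (A.card : ℝ) ≤ r)
    (F T : Finset (Fin n)) (hFT : Disjoint F T)
    (I : Fin n → Finset (Fin m)) (hIA : ∀ v ∈ T, I v ⊆ A)
    (hsupp : ∀ v ∈ T,
      (lincomb (fun e => if e ∈ I v then (1 : ZMod 2) else 0) E).supp ⊆ insert v F)
    (hmem : ∀ v ∈ T, v ∈ (lincomb (fun e => if e ∈ I v then (1 : ZMod 2) else 0) E).supp) :
    (c - 1) * T.card ≤ (F.card : ℝ) := by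
  classical
  set S : Fin m → Finset ℕ := fun i => (E i).supp.map Fin.valEmbedding with hS
  set A' : Finset (Fin m) := T.biUnion I with hA'
  -- `A' ⊆ A`, so expansion applies to `A'`
  have hA'A : A' ⊆ A := Finset.biUnion_subset.2 hIA
  have hA'r : (A'.card : ℝ) ≤ r :=
    le_trans (by exact_mod_cast Finset.card_le_card hA'A) hA
  have hexpA : c * A'.card ≤ ((boundary S A').card : ℝ) := hexp A' hA'r
  -- the boundary of `A'` lies in `F ∪ T`
  have hbd : boundary S A' ⊆ (F ∪ T).map Fin.valEmbedding := by
    intro v hv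
    obtain ⟨t, ht, hvt⟩ := Finset.mem_biUnion.1 (boundary_biUnion_subset S T I hv)
    obtain ⟨j, hj, rfl⟩ := Finset.mem_map.1 (boundary_subset_map_supp_lincomb E (I t) hvt)
    refine Finset.mem_map.2 ⟨j, ?_, rfl⟩
    rcases Finset.mem_insert.1 (hsupp t ht hj) with rfl | hjF
    · exact Finset.mem_union_right _ ht
    · exact Finset.mem_union_left _ hjF
  have hbd_card : ((boundary S A').card : ℝ) ≤ F.card + T.card := by
    have h1 : (boundary S A').card ≤ ((F ∪ T).map Fin.valEmbedding).card :=
      Finset.card_le_card hbd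
    rw [Finset.card_map] at h1
    exact_mod_cast h1.trans (Finset.card_union_le F T)
  -- the sums `w_v` are `|T|` independent vectors in the span of the rows of `A'`
  set w : Fin n → (Fin n → ZMod 2) :=
    fun v => (lincomb (fun e => if e ∈ I v then (1 : ZMod 2) else 0) E).1 with hw
  have hdiag : ∀ v ∈ T, w v v ≠ 0 := fun v hv =>
    (mem_supp_iff_fst_ne_zero _ v).1 (hmem v hv)
  have hoff : ∀ u ∈ T, ∀ v ∈ T, u ≠ v → w u v = 0 := by
    intro u hu v hv huv
    by_contra hne
    have hvs : v ∈ (lincomb (fun e => if e ∈ I u then (1 : ZMod 2) else 0) E).supp :=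
      (mem_supp_iff_fst_ne_zero _ v).2 hne
    rcases Finset.mem_insert.1 (hsupp u hu hvs) with rfl | hvF
    · exact huv rfl
    · exact Finset.disjoint_left.1 hFT hvF hv
  have hli : LinearIndependent (ZMod 2) (fun v : T => w v) :=
    linearIndependent_of_unit_support T w hdiag hoff
  set rows : Finset (Fin n → ZMod 2) := A'.image fun e => (E e).1 with hrows
  set W : Submodule (ZMod 2) (Fin n → ZMod 2) :=
    Submodule.span (ZMod 2) (rows : Set (Fin n → ZMod 2)) with hW
  have hwW : ∀ v ∈ T, w v ∈ W := by
    intro v hv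
    have hfun : w v = ∑ e ∈ I v, (E e).1 := by
      funext j
      rw [Finset.sum_apply]
      exact fst_lincomb_indicator E (I v) j
    rw [hfun]
    refine Submodule.sum_mem W fun e he => Submodule.subset_span ?_
    exact Finset.mem_coe.2 (Finset.mem_image.2 ⟨e, Finset.mem_biUnion.2 ⟨v, hv, he⟩, rfl⟩)
  let b : T → W := fun v => ⟨w v, hwW v v.2⟩
  have hbli : LinearIndependent (ZMod 2) b := LinearIndependent.of_comp W.subtype hli
  have hrank : T.card ≤ A'.card := by
    have h1 : Fintype.card T ≤ Module.finrank (ZMod 2) W := hbli.fintype_card_le_finrank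
    rw [Fintype.card_coe] at h1
    have h2 : Module.finrank (ZMod 2) W ≤ rows.card := finrank_span_finset_le_card rows
    exact h1.trans (h2.trans Finset.card_image_le)
  -- combine
  have hc : c * A'.card ≤ (F.card : ℝ) + T.card := hexpA.trans hbd_card
  have hT : (T.card : ℝ) ≤ A'.card := by exact_mod_cast hrank
  by_cases hc1 : c ≤ 1
  · have h0 : (c - 1) * T.card ≤ 0 :=
      mul_nonpos_of_nonpos_of_nonneg (by linarith) (Nat.cast_nonneg _)
    exact h0.trans (Nat.cast_nonneg _)
  · push Not at hc1
    have h1 : c * T.card ≤ c * A'.card := mul_le_mul_of_nonneg_left hT (by linarith)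
    linarith

/-- The route's normalisation (`c = 3/4·ℓ`, as in `ExpansionForcesDepthFregeSize`): in an
`(r, 3ℓ/4)`-boundary expander, `w` locally fixed bits force at most `w / (3ℓ/4 - 1)` further bits
through any one row set of size `≤ r` — for `ℓ = 9` at most `0.174·w`. In particular pattern
predicates of a common width cannot be chained by locally derived transitivity / successor axioms
(`|F| = 2|T|` resp. `|F| = |T|` would need `ℓ ≤ 4` resp. `ℓ ≤ 8/3`). [memo-11442-s21 §2, §4]
[folklore] -/
theorem card_determined_le_route {m n : ℕ} (ℓ : ℕ) (E : Fin m → LinEqMod 2 n) {r : ℝ}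
    (hexp : IsBoundaryExpander (fun i => (E i).supp.map Fin.valEmbedding) r (3 / 4 * ℓ))
    (A : Finset (Fin m)) (hA : (A.card : ℝ) ≤ r)
    (F T : Finset (Fin n)) (hFT : Disjoint F T)
    (I : Fin n → Finset (Fin m)) (hIA : ∀ v ∈ T, I v ⊆ A)
    (hsupp : ∀ v ∈ T,
      (lincomb (fun e => if e ∈ I v then (1 : ZMod 2) else 0) E).supp ⊆ insert v F)
    (hmem : ∀ v ∈ T, v ∈ (lincomb (fun e => if e ∈ I v then (1 : ZMod 2) else 0) E).supp) :
    (3 / 4 * ℓ - 1) * T.card ≤ (F.card : ℝ) :=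
  card_determined_le E hexp A hA F T hFT I hIA hsupp hmem

/-- **No local pinning.** With expansion constant `c > 1`, no variable is pinned by a row set of
size `≤ r`: there is no `I ⊆ A`, `|A| ≤ r`, whose sum is supported on a single variable
(`F = ∅` in the Determination Principle). [memo-11442-s21 §2 (KEY PRINCIPLE)] [folklore] -/
theorem not_locallyPinned {m n : ℕ} (E : Fin m → LinEqMod 2 n) {r c : ℝ} (hc : 1 < c)
    (hexp : IsBoundaryExpander (fun i => (E i).supp.map Fin.valEmbedding) r c)
    (I : Finset (Fin m)) (hI : (I.card : ℝ) ≤ r) (v : Fin n)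
    (hsupp : (lincomb (fun e => if e ∈ I then (1 : ZMod 2) else 0) E).supp ⊆ {v}) :
    v ∉ (lincomb (fun e => if e ∈ I then (1 : ZMod 2) else 0) E).supp := by
  classical
  intro hv
  have h := card_determined_le E hexp I hI ∅ {v} (Finset.disjoint_empty_left _)
    (fun _ => I) (fun _ _ => le_rfl) (fun u hu => ?_) (fun u hu => ?_)
  · simp only [Finset.card_empty, Nat.cast_zero, Finset.card_singleton, Nat.cast_one,
      mul_one] at h
    linarith
  · rw [Finset.mem_singleton.1 hu]
    simpa using hsupp
  · rw [Finset.mem_singleton.1 hu]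
    exact hv

/-- **Key Principle** (local rows pin at most a `1/c` fraction of any set of coordinates). Let
`A` be a row set with `|A| ≤ r` of an `(r, c)`-boundary expander and `T` a set of variables.
Every linearly independent family of `k` consequences of `A` (sums of row sets `I_j ⊆ A`) that
are all supported inside `T` has `c · k ≤ |T|`: the consequences of `A` living on `T` span a
space of dimension `≤ |T| / c`, so on the solutions of `A` the coordinates in `T` keep at least
`(1 - 1/c)·|T|` degrees of freedom (no pattern of width `w` can be locally trimmed to fewer than
`2^{(1 - 1/c) w}` live values — the cover bound of the counting-frame barrier).
Proof: `A' := ⋃_j I_j` has `∂A' ⊆ T`, so `c|A'| ≤ |T|`, and the `k` sums are independent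
vectors in the span of the `|A'|` rows of `A'`. [memo-11442-s21 §2 (KEY PRINCIPLE, Cor. B(i))]
[folklore] -/
theorem card_le_of_linearIndependent_local {m n k : ℕ} (E : Fin m → LinEqMod 2 n) {r c : ℝ}
    (hexp : IsBoundaryExpander (fun i => (E i).supp.map Fin.valEmbedding) r c)
    (A : Finset (Fin m)) (hA : (A.card : ℝ) ≤ r) (T : Finset (Fin n))
    (I : Fin k → Finset (Fin m)) (hIA : ∀ j, I j ⊆ A)
    (hsupp : ∀ j, (lincomb (fun e => if e ∈ I j then (1 : ZMod 2) else 0) E).supp ⊆ T)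
    (hli : LinearIndependent (ZMod 2)
      fun j : Fin k => (lincomb (fun e => if e ∈ I j then (1 : ZMod 2) else 0) E).1) :
    c * k ≤ (T.card : ℝ) := by
  classical
  set S : Fin m → Finset ℕ := fun i => (E i).supp.map Fin.valEmbedding with hS
  set A' : Finset (Fin m) := (Finset.univ : Finset (Fin k)).biUnion I with hA'
  have hA'A : A' ⊆ A := Finset.biUnion_subset.2 fun j _ => hIA j
  have hA'r : (A'.card : ℝ) ≤ r :=
    le_trans (by exact_mod_cast Finset.card_le_card hA'A) hA
  have hexpA : c * A'.card ≤ ((boundary S A').card : ℝ) := hexp A' hA'r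
  -- the boundary of `A'` lies in `T`
  have hbd : boundary S A' ⊆ T.map Fin.valEmbedding := by
    intro v hv
    obtain ⟨j, -, hvj⟩ :=
      Finset.mem_biUnion.1 (boundary_biUnion_subset S (Finset.univ : Finset (Fin k)) I hv)
    obtain ⟨x, hx, rfl⟩ := Finset.mem_map.1 (boundary_subset_map_supp_lincomb E (I j) hvj)
    exact Finset.mem_map.2 ⟨x, hsupp j hx, rfl⟩
  have hbd_card : ((boundary S A').card : ℝ) ≤ T.card := by
    have h1 : (boundary S A').card ≤ (T.map Fin.valEmbedding).card := Finset.card_le_card hbd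
    rw [Finset.card_map] at h1
    exact_mod_cast h1
  -- the `k` sums are independent vectors in the span of the rows of `A'`
  set rows : Finset (Fin n → ZMod 2) := A'.image fun e => (E e).1 with hrows
  set W : Submodule (ZMod 2) (Fin n → ZMod 2) :=
    Submodule.span (ZMod 2) (rows : Set (Fin n → ZMod 2)) with hW
  have hwW : ∀ j : Fin k,
      (lincomb (fun e => if e ∈ I j then (1 : ZMod 2) else 0) E).1 ∈ W := by
    intro j
    have hfun : (lincomb (fun e => if e ∈ I j then (1 : ZMod 2) else 0) E).1 =
        ∑ e ∈ I j, (E e).1 := by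
      funext x
      rw [Finset.sum_apply]
      exact fst_lincomb_indicator E (I j) x
    rw [hfun]
    refine Submodule.sum_mem W fun e he => Submodule.subset_span ?_
    exact Finset.mem_coe.2
      (Finset.mem_image.2 ⟨e, Finset.mem_biUnion.2 ⟨j, Finset.mem_univ j, he⟩, rfl⟩)
  let b : Fin k → W :=
    fun j => ⟨(lincomb (fun e => if e ∈ I j then (1 : ZMod 2) else 0) E).1, hwW j⟩
  have hbli : LinearIndependent (ZMod 2) b := LinearIndependent.of_comp W.subtype hli
  have hrank : k ≤ A'.card := by
    have h1 : Fintype.card (Fin k) ≤ Module.finrank (ZMod 2) W := hbli.fintype_card_le_finrank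
    rw [Fintype.card_fin] at h1
    have h2 : Module.finrank (ZMod 2) W ≤ rows.card := finrank_span_finset_le_card rows
    exact h1.trans (h2.trans Finset.card_image_le)
  -- combine
  have hk : (k : ℝ) ≤ A'.card := by exact_mod_cast hrank
  by_cases hc0 : c ≤ 0
  · have h0 : c * k ≤ 0 := mul_nonpos_of_nonpos_of_nonneg hc0 (Nat.cast_nonneg _)
    exact h0.trans (Nat.cast_nonneg _)
  · push Not at hc0
    have h1 : c * k ≤ c * A'.card := mul_le_mul_of_nonneg_left hk hc0.le
    linarith

end DeterminationBarrier

end Summit.PneNP.PneNP.Theorems
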